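import Literature.AnabelianGeometry.SemiGraphs.TemperedVerticial
import Literature.AnabelianGeometry.SemiGraphs.Temperoids

/-!
# [SemiAnbd] Prop. 3.6 (ii), «in particular» clause: `B^temp(𝒢)` is a connected temperoid

Mochizuki, *Semi-graphs of anabelioids*, Publ. RIMS **42** (2006), Prop. 3.6 (ii), p. 262:
«There is a natural equivalence of categories `B^temp(π₁^temp(𝒢)) ⥲ B^temp(𝒢)`. In particular, the
category `B^temp(𝒢)` is a connected temperoid.»  In the tree the first sentence is the datum
`TemperedPiChart 𝒢` (a tempered group `Π` with `B^temp(𝒢) ≌ B^temp(Π)`, `TemperedCoverings.lean`) and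
the named fact `ExistsTemperedPiChart` (`TemperedVerticial.lean`); a connected temperoid is, by
Definition 3.1 (ii) (`Temperoids.lean`, `IsConnectedTemperoid`), any category equivalent to some
`B^temp(Π)` with `Π` tempered.  This file records the «in particular» clause: a chart IS such a
presentation, so `B^temp(𝒢)` is a connected temperoid as soon as a chart exists, in particular
under the hypotheses of Proposition 3.6 granted `ExistsTemperedPiChart`.  (Conversely a
connected-temperoid presentation by a second-countable tempered group is a chart; not needed here.)
Sub-DAG row E6 («connected temperoid» half) of plan/L3/SUBDAG-SemiAnbd-Prop36ii.md (cell abc-iut).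
Proof-only: no new definitions.
-/

namespace Literature.AnabelianGeometry.SemiGraphs

namespace ProfiniteSemiGraph

open CategoryTheory

universe u

variable {𝒢 : ProfiniteSemiGraph.{u}}

/-- **[SemiAnbd] Prop. 3.6 (ii), «in particular»: `B^temp(𝒢)` is a connected temperoid** — for any
`𝒢` admitting a tempered-fundamental-group chart: the chart's group and equivalence are a
connected-temperoid presentation (Def. 3.1 (ii)). [cite: MochizukiSemiAnbd2006, Prop 3.6(ii) p.38] -/
theorem TemperedPiChart.isConnectedTemperoid (c : TemperedPiChart 𝒢) :
    IsConnectedTemperoid.{u, u, u + 1} (BTempCat 𝒢) :=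
  ⟨{ G := c.G, isTempered := c.isTempered, equiv := c.equiv }⟩

/-- `B^temp(𝒢)` is a connected temperoid as soon as a chart exists (`Nonempty` form).
[cite: MochizukiSemiAnbd2006, Prop 3.6(ii) p.38] -/
theorem isConnectedTemperoid_of_nonempty_temperedPiChart (h : Nonempty (TemperedPiChart 𝒢)) :
    IsConnectedTemperoid.{u, u, u + 1} (BTempCat 𝒢) :=
  h.elim fun c => c.isConnectedTemperoid

/-- **[SemiAnbd] Prop. 3.6 (ii), «in particular», under the hypotheses of Proposition 3.6**: granted
the named fact `ExistsTemperedPiChart` (Prop. 3.6 (i)–(ii): a chart exists for every `𝒢` satisfying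
`Prop36Hypotheses`), the category `B^temp(𝒢)` of tempered coverings of such a `𝒢` is a connected
temperoid. [cite: MochizukiSemiAnbd2006, Prop 3.6(ii) p.38] -/
theorem isConnectedTemperoid_of_existsTemperedPiChart (hex : ExistsTemperedPiChart.{u})
    (𝒢 : ProfiniteSemiGraph.{u}) (h36 : 𝒢.Prop36Hypotheses) :
    IsConnectedTemperoid.{u, u, u + 1} (BTempCat 𝒢) :=
  isConnectedTemperoid_of_nonempty_temperedPiChart (hex 𝒢 h36)

end ProfiniteSemiGraph

end Literature.AnabelianGeometry.SemiGraphs
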